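import Summits.FinalStateConjecture.FinalStateConjecture.Theorems.ZeroEnergyKerrOrBombSymplecticDualOfTheBombDefs

/-!
# Crux `FinalStateFromKerrOrBomb` (stmt-FinalStateConjecture-17839), line m1 (`Lines/SketchIdeator1.lean`) —
# negative-side typing certificate for the detector clause of stubs 4-residuals / 5′:
# LOCALLY VANISHING DETECTORS ARE PURE GAUGE, HENCE NOT DETECTORS

The picked line of the crux (lead, 2026-08-17, shape m1) carries the predecessor's Moncrief machinery:
its front stub 5′ `SigM.stub_dualModeEjectionModT` concludes `∃ x₀ k A B, AreSymmDetectorsAt 𝒟 x₀ A B ∧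
∀ G, … → det (pairingMatrix D x₀ A B G) ≠ 0 → …`, and the composition feeds those detectors to stub
4-residuals (`LocalSingleDetectionAt`) to obtain a family `G` with non-singular pairing.  The wave-1
drefuter of the predecessor crux found that the ORIGINAL detector notion collapsed (antisymmetric
detectors pair to zero with every family, `det_pairingMatrix_eq_zero_of_antisymm`, p104819); the repair
(`AreSymmDetectorsAt`) asks symmetric detectors.  This file closes, kernel-checked, the next cheapest
degeneration one could try against the repaired clause — detectors VANISHING near the base point (their
chart pairing with every family supported near `x₀` is zero, so the steering clause of 5′ would again be
vacuous):

* `isLocalSliceTangentAt_of_forall_eq_zero` — a pair `(A, B)` of bilinear-form fields vanishing on an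
  open neighbourhood of `x₀` IS a local slice tangent at `x₀` (`IsLocalSliceTangentAt`): the trivial
  deformation `ι_s = ι`, `ν_s = ν` of the Cauchy surface inside the development has induced data
  constant in `s`, whose `s`-derivatives `(0, 0)` agree with `(A, B)` there;
* `not_areDetectorsAt_of_forall_eq_zero` — hence NO family of `k ≥ 1` detectors all of which vanish on a
  common open neighbourhood of `x₀` satisfies `AreDetectorsAt 𝒟 x₀ A B` (its third clause — no
  non-trivial combination is locally pure gauge — fails for every coefficient vector);
* `exists_ne_zero_near_of_areDetectorsAt` — equivalently, detectors have a non-vanishing GERM at `x₀`: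
  every open neighbourhood of `x₀` contains a point where some `A j` or `B j` is non-zero.

So the non-gauge clause of `AreDetectorsAt` has teeth at the germ of `x₀` (where `chartPairing`
integrates), and the content of 5′ cannot be discharged by degenerate detectors; what it CAN be
discharged by is constrained only through stub 4 (`LocalSingleDetectionAt`), jointly.  Pure typing over
the landed Defs module (p85447 lineage); no definition, no named fact.
-/

noncomputable section

-- every `Summit.FinalStateConjecture.FinalStateConjecture.…` name repeats the summit = sub-problem
-- segment (D-0017 layout); the duplicate is deliberate.
set_option linter.dupNamespace false
set_option maxSynthPendingDepth 3

open scoped Manifold ContDiff Topology BigOperators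
open Set Filter Bundle Literature.Geometry.Lorentzian

namespace Summit.FinalStateConjecture.FinalStateConjecture.Theorems.FinalStateFromKerrOrBomb.Negative

open Summit.FinalStateConjecture.FinalStateConjecture.Theorems.SymplecticDualOfTheBomb

variable {X : Type} [TopologicalSpace X] [ChartedSpace E3 X] [IsManifold (𝓡 3) ∞ X]
  [ConnectedSpace X] {D : InitialDataSet (𝓡 3) X}

/-- **A pair vanishing near `x₀` is a local slice tangent at `x₀`.** If `A` and `B` vanish on an open
neighbourhood `V` of `x₀`, then `(A, B)` is locally pure gauge at `x₀` in every vacuum Cauchy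
development `𝒟` of the data: the trivial one-parameter deformation `ι_s := ι`, `ν_s := ν` (the
development's own embedding and future unit normal, for all `s`) is jointly smooth, has the required
normals, and its induced data are constant in `s`, with `s`-derivatives `0 = A`, `0 = B` on `V`. -/
theorem isLocalSliceTangentAt_of_forall_eq_zero (𝒟 : VacuumCauchyDevelopment D) {A B : BilinField X}
    {x₀ : X} {V : Set X} (hV : IsOpen V) (hx₀ : x₀ ∈ V) (hA : ∀ y ∈ V, A y = 0)
    (hB : ∀ y ∈ V, B y = 0) : IsLocalSliceTangentAt 𝒟 A B x₀ := by
  refine ⟨V, 1, hV, hx₀, one_pos, fun _ ↦ 𝒟.embed, fun _ ↦ 𝒟.normal, rfl, ?_, ?_, ?_⟩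
  · exact (𝒟.isSmoothEmbedding.contMDiff.comp contMDiff_snd).contMDiffOn
  · intro s _ y _
    obtain ⟨⟨hnormal, hunit⟩, hfut⟩ := 𝒟.isFutureUnitNormal
    exact ⟨fun v ↦ hnormal y v, hunit y, hfut y⟩
  · intro y hy v w
    have hA0 : A y v w = 0 := by rw [hA y hy]; rfl
    have hB0 : B y v w = 0 := by rw [hB y hy]; rfl
    rw [hA0, hB0]
    exact ⟨hasDerivAt_const 0 _, hasDerivAt_const 0 _⟩

/-- **Locally vanishing detectors are not detectors.** If `k ≥ 1` (witnessed by an index `j₀`) and all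
the fields `A j`, `B j` vanish on a common open neighbourhood `V` of `x₀`, then `AreDetectorsAt 𝒟 x₀ A B`
fails: the combination with coefficient vector `e_{j₀} ≠ 0` vanishes on `V`, hence is a local slice
tangent at `x₀`, contradicting the non-gauge clause. -/
theorem not_areDetectorsAt_of_forall_eq_zero (𝒟 : VacuumCauchyDevelopment D) {x₀ : X} {k : ℕ}
    {A B : Fin k → BilinField X} (j₀ : Fin k) {V : Set X} (hV : IsOpen V) (hx₀ : x₀ ∈ V)
    (hA : ∀ j, ∀ y ∈ V, A j y = 0) (hB : ∀ j, ∀ y ∈ V, B j y = 0) : ¬ AreDetectorsAt 𝒟 x₀ A B := by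
  rintro ⟨-, -, hng⟩
  have hne : (Pi.single j₀ 1 : Fin k → ℝ) ≠ 0 := fun h ↦ by simpa using congrFun h j₀
  refine hng (Pi.single j₀ 1) hne (isLocalSliceTangentAt_of_forall_eq_zero 𝒟 hV hx₀ ?_ ?_)
  · intro y hy
    exact Finset.sum_eq_zero fun j _ ↦ by rw [hA j y hy, smul_zero]
  · intro y hy
    exact Finset.sum_eq_zero fun j _ ↦ by rw [hB j y hy, smul_zero]

/-- **Detectors have a non-vanishing germ at the base point.** If `AreDetectorsAt 𝒟 x₀ A B` holds with
`k ≥ 1` detectors, then every open neighbourhood of `x₀` contains a point at which some `A j` or some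
`B j` is non-zero (so the chart pairings at `x₀`, which integrate over the chart of `x₀`, can see them). -/
theorem exists_ne_zero_near_of_areDetectorsAt (𝒟 : VacuumCauchyDevelopment D) {x₀ : X} {k : ℕ}
    {A B : Fin k → BilinField X} (h : AreDetectorsAt 𝒟 x₀ A B) (j₀ : Fin k) {V : Set X}
    (hV : IsOpen V) (hx₀ : x₀ ∈ V) : ∃ j, ∃ y ∈ V, A j y ≠ 0 ∨ B j y ≠ 0 := by
  by_contra hcon
  push Not at hcon
  exact not_areDetectorsAt_of_forall_eq_zero 𝒟 j₀ hV hx₀ (fun j y hy ↦ (hcon j y hy).1)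
    (fun j y hy ↦ (hcon j y hy).2) h

end Summit.FinalStateConjecture.FinalStateConjecture.Theorems.FinalStateFromKerrOrBomb.Negative

end
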